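import Summits.NavierStokesRegularity.NavierStokesRegularity.Theorems.EulerZoomLiouvillePowerGaugeEulerLiouvilleEnergySaturationFluxLoc
import Summits.NavierStokesRegularity.NavierStokesRegularity.Theorems.EulerZoomLiouvillePowerGaugeEulerLiouvilleEnergySaturation

/-!
# Energy saturation on rung C1 of the crux `EulerZoomLiouville.PowerGaugeEulerLiouville` — LARGE-SCALE re-plumb, V:
# the Bronzi–Shvydkoy dichotomy in Seregin's weak class under THRESHOLDED ball growth (profile level)
# (crux = stmt-NavierStokesRegularity-19832, route №10 `EulerZoomLiouville`, line `birth`)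

Width seat `ns-ezl-w1` (RESIDUE-MEMO-19832-g9 §2).  Sequel of `…EnergySaturationFluxLoc`: the tree's profile-level main
theorems `tendsto_normEnergy` and `ae_eq_zero_of_subExtremal` (`…EnergySaturation`) re-proved VERBATIM with the all-scale
`A`-growth and the global `E`/`D`-weights replaced by the thresholded ball forms for `L ≥ 1`

* (A₁) `∫_{B_L}|V|² ≤ c L^{1−2ρ}`, (E₁) `∫_{B_L}|G|²_F ≤ L^{1−ρ}·((1−ρ)/(2+ρ))c`, (D₁) `∫_{B_L}|P|^{3/2} ≤ L^{2−2ρ}·((2−2ρ)/(2+ρ))c`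

— exactly what the profile of a SHIFTED or PAST-EXACT self-similar member of the power-gauged class supplies
(`Past.profileData_of_past`, after normalising thresholds and constants):

* `tendsto_normEnergy_loc` — the normalised energy `L^{2ρ−1}∫σ(L⁻¹y)|V|²` converges as `L → ∞`;
* `ae_eq_zero_of_subExtremal_loc` — `liminf_{L→∞} L^{2ρ−1}∫_{B_L}|V|² = 0 ⇒ V = 0` a.e. (Bronzi–Shvydkoy 2015 Thm 1.1 in the
  weak class, large-scale data only).

WHAT THIS IS NOT: not NS regularity, not the crux, not rung C1 — the sub-extremal stratum for shifted / past-exact members at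
PROFILE level; `--supports` stmt-19832. [folklore; cf. BronziShvydkoy2015 Thm 1.1]
-/

noncomputable section

set_option linter.dupNamespace false

open MeasureTheory Set Filter Topology Metric Function TopologicalSpace
open scoped ENNReal NNReal RealInnerProductSpace ContDiff Laplacian

namespace Summit.NavierStokesRegularity.NavierStokesRegularity.Theorems.PowerGaugeEulerLiouville

open Literature.Analysis Literature.Analysis.FunctionSpaces Literature.Analysis.FluidPDE

namespace EnergySaturation

variable {ρ : ℝ} {σ : EuclideanSpace ℝ (Fin 3) → ℝ}
  {V : EuclideanSpace ℝ (Fin 3) → EuclideanSpace ℝ (Fin 3)} {P : EuclideanSpace ℝ (Fin 3) → ℝ}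
  {G : EuclideanSpace ℝ (Fin 3) → EuclideanSpace ℝ (Fin 3) →L[ℝ] EuclideanSpace ℝ (Fin 3)}

/-! ## Convergence of the normalised energy (large-scale data) -/

/-- **The normalised profile energy converges — LARGE-SCALE data.**  Under the thresholded profile-side class data (A₁), (E₁), (D₁), the weak Poisson
equation and the profile local energy equality (for every test function), for every cut-off `σ` with
`0 ≤ σ ≤ 1`, `σ = 1` on `B̄₁`, `σ = 0` off `B₂`: `N_σ(L) = L^{2ρ−1}∫σ(L⁻¹y)|V|²` has a limit as `L → ∞`
(the two-sided energy law of Bronzi–Shvydkoy 2015 Thm 1.1 / Rem 1.4 in Seregin's weak class).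
[folklore; cf. BronziShvydkoy2015 Thm 1.1] -/
theorem tendsto_normEnergy_loc (hρ : 0 < ρ) (hρ1 : ρ < 1)
    (hσ : IsTestFunctionOn (⊤ : Opens (EuclideanSpace ℝ (Fin 3))) σ) (h0 : ∀ z, 0 ≤ σ z)
    (h1 : ∀ z, σ z ≤ 1) (hone : ∀ z, ‖z‖ ≤ 1 → σ z = 1) (hzero : ∀ z, 2 ≤ ‖z‖ → σ z = 0)
    (hVm : AEStronglyMeasurable V volume) (hPm : AEStronglyMeasurable P volume)
    (hGm : AEStronglyMeasurable G volume)
    (hVG : HasWeakFDerivOn (⊤ : Opens (EuclideanSpace ℝ (Fin 3))) volume V G) {c : ℝ≥0}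
    (hA : ∀ L : ℝ, 1 ≤ L → ∫⁻ y in ball (0 : EuclideanSpace ℝ (Fin 3)) L, ‖V y‖ₑ ^ 2 ≤
      (c : ℝ≥0∞) * ENNReal.ofReal (L ^ (1 - 2 * ρ)))
    (hE : ∀ L : ℝ, 1 ≤ L →
      ∫⁻ y in ball (0 : EuclideanSpace ℝ (Fin 3)) L, ENNReal.ofReal (frobeniusNormSq (G y)) ≤
        ENNReal.ofReal (L ^ (1 - ρ)) * (ENNReal.ofReal ((1 - ρ) / (2 + ρ)) * (c : ℝ≥0∞)))
    (hD : ∀ L : ℝ, 1 ≤ L →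
      ∫⁻ y in ball (0 : EuclideanSpace ℝ (Fin 3)) L, ‖P y‖ₑ ^ (3 / 2 : ℝ) ≤
        ENNReal.ofReal (L ^ (2 - 2 * ρ)) * (ENNReal.ofReal ((2 - 2 * ρ) / (2 + ρ)) * (c : ℝ≥0∞)))
    (hPoisson : ∀ θ : EuclideanSpace ℝ (Fin 3) → ℝ, ContDiff ℝ (⊤ : ℕ∞) θ → HasCompactSupport θ →
      ∫ y, P y * (Δ θ) y = -∫ y, fderiv ℝ (fderiv ℝ θ) y (V y) (V y))
    (hEE : ∀ θ : EuclideanSpace ℝ (Fin 3) → ℝ, IsTestFunctionOn (⊤ : Opens (EuclideanSpace ℝ (Fin 3))) θ →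
      (2 - 5 * (1 / (2 + ρ))) * ∫ x, θ x * ‖V x‖ ^ 2 =
        (∫ x, (‖V x‖ ^ 2 + 2 * P x) * ⟪V x, gradient θ x⟫) +
          (1 / (2 + ρ)) * ∫ x, ‖V x‖ ^ 2 * ⟪x, gradient θ x⟫) :
    ∃ Ninf : ℝ, Tendsto (fun L : ℝ => L ^ (2 * ρ - 1) * ∫ y, σ (L⁻¹ • y) * ‖V y‖ ^ 2) atTop (𝓝 Ninf) := by
  have hc0 : (0 : ℝ) ≤ c := c.2
  have hV2 : LocallyIntegrable (fun y => ‖V y‖ ^ 2) volume := locallyIntegrable_norm_sq_of_growth_loc hVm hA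
  have hEEσ : ∀ L : ℝ, 0 < L → (2 - 5 * (1 / (2 + ρ))) * ∫ x, σ (L⁻¹ • x) * ‖V x‖ ^ 2 =
      (∫ x, (‖V x‖ ^ 2 + 2 * P x) * ⟪V x, gradient (fun z => σ (L⁻¹ • z)) x⟫) +
        (1 / (2 + ρ)) * ∫ x, ‖V x‖ ^ 2 * ⟪x, gradient (fun z => σ (L⁻¹ • z)) x⟫ :=
    fun L hL => hEE _ (isTestFunctionOn_comp_inv_smul hσ hL.ne')
  obtain ⟨A, hA0, hflux⟩ := exists_fluxWeight_le_of_sup_loc hρ hρ1 hσ h0 h1 hone hzero hVm hPm hGm hVG hA hE hD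
    hPoisson
  -- the tail supremum `S = 3c` is admissible on `[1, ∞)`
  have hsup3 : ∀ R : ℝ, 1 ≤ R → ∫ y, σ (R⁻¹ • y) * ‖V y‖ ^ 2 ≤ R ^ (1 - 2 * ρ) * (3 * c) :=
    fun R hR => cutoffEnergy_le_three_loc hρ h0 h1 hzero hVm hA hR
  have hfl := hflux (3 * c) (by positivity) le_rfl 1 le_rfl hsup3
  -- the flux weight `g`
  set g : ℝ → ℝ := fun r => (2 + ρ) * r ^ (2 * ρ - 2) *
    ∫ x, (‖V x‖ ^ 2 + 2 * P x) * ⟪V x, gradient (fun z => σ (r⁻¹ • z)) x⟫ with hg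
  have hgcont : ContinuousOn g (Ioi 1) := fun r hr =>
    (continuousAt_fluxWeight hρ hσ hVm hV2 hEEσ (lt_trans one_pos hr)).continuousWithinAt
  -- `g` is integrable on `(1, ∞)`
  set a : ℝ := (2 + ρ) / 4 with hadef
  have ha0 : 0 < a := by rw [hadef]; positivity
  have hgint : IntegrableOn g (Ioi 1) volume := by
    have hbound : IntegrableOn (fun r : ℝ => A * (3 * c) ^ (1 / 2 : ℝ) * r ^ (-1 - a)) (Ioi 1) volume :=
      ((integrableOn_Ioi_rpow_of_lt (by linarith) one_pos).const_mul _)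
    refine Integrable.mono' hbound (hgcont.aestronglyMeasurable measurableSet_Ioi) ?_
    rw [ae_restrict_iff' measurableSet_Ioi]
    refine Eventually.of_forall fun r hr => ?_
    rw [Real.norm_eq_abs]
    have := hfl r (le_of_lt hr)
    rwa [hadef]
  -- `N(L) = N(1) + ∫_1^L g` and the improper integral converges
  have hlim := intervalIntegral_tendsto_integral_Ioi 1 hgint tendsto_id
  refine ⟨1 ^ (2 * ρ - 1) * (∫ y, σ ((1 : ℝ)⁻¹ • y) * ‖V y‖ ^ 2) + ∫ r in Ioi 1, g r, ?_⟩
  refine ((tendsto_const_nhds.add hlim).congr' ?_)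
  filter_upwards [eventually_ge_atTop (1 : ℝ)] with L hL
  have hid := normEnergy_sub_eq_integral_flux hρ hσ hVm hV2 hEEσ one_pos hL
  simp only [id, hg] at hid ⊢
  linarith

/-! ## Sub-extremal profiles are trivial (large-scale data) -/

/-- **SUB-EXTREMAL PROFILES ARE TRIVIAL — LARGE-SCALE data (Bronzi–Shvydkoy in Seregin's weak class).**  Let
`(V, P, G)` carry the thresholded profile-side class data with exponent `0 < ρ < 1` ((A₁), (E₁), (D₁) for `L ≥ 1`), the weak
Poisson equation, and the profile local energy EQUALITY for every test function.  If the normalised ball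
energy is not bounded below — `∀ ε > 0, ∀ L₀, ∃ L ≥ L₀, L^{2ρ−1} ∫_{B_L}|V|² < ε`, i.e.
`liminf_{L→∞} L^{2ρ−1}∫_{B_L}|V|² = 0` — then `V = 0` a.e.  Contrapositive: a nontrivial profile
saturates the `A`-gauge, `∫_{B_L}|V|² ≥ c₁ L^{1−2ρ}` for all large `L` (`c₁ > 0`) — Bronzi–Shvydkoy 2015
Thm 1.1 without `C³`, without the `L^p` shell hypothesis, for every `ρ ∈ (0,1)`; the direction
`N_σ' ≥ −|flux|` it rests on is exactly the Euler identity (no anomalous dissipation), unavailable from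
the local energy inequality. [folklore; cf. BronziShvydkoy2015 Thm 1.1] -/
theorem ae_eq_zero_of_subExtremal_loc (hρ : 0 < ρ) (hρ1 : ρ < 1)
    (hVm : AEStronglyMeasurable V volume) (hPm : AEStronglyMeasurable P volume)
    (hGm : AEStronglyMeasurable G volume)
    (hVG : HasWeakFDerivOn (⊤ : Opens (EuclideanSpace ℝ (Fin 3))) volume V G) {c : ℝ≥0}
    (hA : ∀ L : ℝ, 1 ≤ L → ∫⁻ y in ball (0 : EuclideanSpace ℝ (Fin 3)) L, ‖V y‖ₑ ^ 2 ≤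
      (c : ℝ≥0∞) * ENNReal.ofReal (L ^ (1 - 2 * ρ)))
    (hE : ∀ L : ℝ, 1 ≤ L →
      ∫⁻ y in ball (0 : EuclideanSpace ℝ (Fin 3)) L, ENNReal.ofReal (frobeniusNormSq (G y)) ≤
        ENNReal.ofReal (L ^ (1 - ρ)) * (ENNReal.ofReal ((1 - ρ) / (2 + ρ)) * (c : ℝ≥0∞)))
    (hD : ∀ L : ℝ, 1 ≤ L →
      ∫⁻ y in ball (0 : EuclideanSpace ℝ (Fin 3)) L, ‖P y‖ₑ ^ (3 / 2 : ℝ) ≤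
        ENNReal.ofReal (L ^ (2 - 2 * ρ)) * (ENNReal.ofReal ((2 - 2 * ρ) / (2 + ρ)) * (c : ℝ≥0∞)))
    (hPoisson : ∀ θ : EuclideanSpace ℝ (Fin 3) → ℝ, ContDiff ℝ (⊤ : ℕ∞) θ → HasCompactSupport θ →
      ∫ y, P y * (Δ θ) y = -∫ y, fderiv ℝ (fderiv ℝ θ) y (V y) (V y))
    (hEE : ∀ θ : EuclideanSpace ℝ (Fin 3) → ℝ, IsTestFunctionOn (⊤ : Opens (EuclideanSpace ℝ (Fin 3))) θ →
      (2 - 5 * (1 / (2 + ρ))) * ∫ x, θ x * ‖V x‖ ^ 2 =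
        (∫ x, (‖V x‖ ^ 2 + 2 * P x) * ⟪V x, gradient θ x⟫) +
          (1 / (2 + ρ)) * ∫ x, ‖V x‖ ^ 2 * ⟪x, gradient θ x⟫)
    (hsub : ∀ ε : ℝ, 0 < ε → ∀ L₀ : ℝ, ∃ L : ℝ, L₀ ≤ L ∧
      L ^ (2 * ρ - 1) * ∫ y in ball (0 : EuclideanSpace ℝ (Fin 3)) L, ‖V y‖ ^ 2 < ε) :
    V =ᵐ[volume] 0 := by
  have hc0 : (0 : ℝ) ≤ c := c.2
  have hV2 : LocallyIntegrable (fun y => ‖V y‖ ^ 2) volume := locallyIntegrable_norm_sq_of_growth_loc hVm hA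
  -- the radial cut-off
  obtain ⟨σ, hσs, hσc, h0, h1, hone, hzero, -⟩ := exists_radialCutoff
  have hσ : IsTestFunctionOn (⊤ : Opens (EuclideanSpace ℝ (Fin 3))) σ := ⟨hσs, hσc, fun _ _ => trivial⟩
  have hEEσ : ∀ L : ℝ, 0 < L → (2 - 5 * (1 / (2 + ρ))) * ∫ x, σ (L⁻¹ • x) * ‖V x‖ ^ 2 =
      (∫ x, (‖V x‖ ^ 2 + 2 * P x) * ⟪V x, gradient (fun z => σ (L⁻¹ • z)) x⟫) +
        (1 / (2 + ρ)) * ∫ x, ‖V x‖ ^ 2 * ⟪x, gradient (fun z => σ (L⁻¹ • z)) x⟫ :=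
    fun L hL => hEE _ (isTestFunctionOn_comp_inv_smul hσ hL.ne')
  -- the normalised energy `N`
  set N : ℝ → ℝ := fun R => R ^ (2 * ρ - 1) * ∫ y, σ (R⁻¹ • y) * ‖V y‖ ^ 2 with hN
  have hN0 : ∀ R, 0 < R → 0 ≤ N R := fun R hR =>
    mul_nonneg (Real.rpow_nonneg hR.le _) (integral_nonneg fun y => mul_nonneg (h0 _) (sq_nonneg _))
  have hN3 : ∀ R, 1 ≤ R → N R ≤ 3 * c := by
    intro R hR
    have h := normEnergy_le_of_growth_loc (ρ := ρ) h0 h1 hzero hVm hA hR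
    have h3 : (3 : ℝ) ^ (1 - 2 * ρ) ≤ 3 := by
      conv_rhs => rw [← Real.rpow_one 3]
      exact Real.rpow_le_rpow_of_exponent_le (by norm_num) (by linarith)
    exact h.trans (by gcongr)
  -- the flux weight bound and the tail estimate
  obtain ⟨A, hA0, hflux⟩ := exists_fluxWeight_le_of_sup_loc hρ hρ1 hσ h0 h1 hone hzero hVm hPm hGm hVG hA hE hD
    hPoisson
  set a : ℝ := (2 + ρ) / 4 with hadef
  have ha0 : 0 < a := by rw [hadef]; positivity
  set B₀ : ℝ := A / a with hB₀
  have hB₀0 : 0 ≤ B₀ := div_nonneg hA0 ha0.le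
  -- admissible `S` on `[L, ∞)` ⇒ tail estimate
  have htail : ∀ L : ℝ, 1 ≤ L → ∀ S : ℝ, 0 ≤ S → S ≤ 3 * c → (∀ R, L ≤ R → N R ≤ S) →
      ∀ L₁ L₂ : ℝ, L ≤ L₁ → L₁ ≤ L₂ → |N L₂ - N L₁| ≤ B₀ * S ^ (1 / 2 : ℝ) * L₁ ^ (-a) := by
    intro L hL S hS hS3 hSsup L₁ L₂ hL₁ h12
    have hL0 : 0 < L := lt_of_lt_of_le one_pos hL
    have hsup' : ∀ R : ℝ, L ≤ R → ∫ y, σ (R⁻¹ • y) * ‖V y‖ ^ 2 ≤ R ^ (1 - 2 * ρ) * S := by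
      intro R hR
      have hR0 : 0 < R := lt_of_lt_of_le hL0 hR
      have h := hSsup R hR
      have hRR : R ^ (1 - 2 * ρ) * R ^ (2 * ρ - 1) = 1 := by rw [← Real.rpow_add hR0]; norm_num
      calc ∫ y, σ (R⁻¹ • y) * ‖V y‖ ^ 2 = R ^ (1 - 2 * ρ) * N R := by
            simp only [hN]; rw [← mul_assoc, hRR, one_mul]
        _ ≤ R ^ (1 - 2 * ρ) * S := mul_le_mul_of_nonneg_left h (Real.rpow_nonneg hR0.le _)
    have hfl := hflux S hS hS3 L hL hsup'
    have hfl' : ∀ r : ℝ, L ≤ r → |(2 + ρ) * r ^ (2 * ρ - 2) *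
        ∫ x, (‖V x‖ ^ 2 + 2 * P x) * ⟪V x, gradient (fun z => σ (r⁻¹ • z)) x⟫| ≤
        (A * S ^ (1 / 2 : ℝ)) * r ^ (-1 - a) := fun r hr => by rw [hadef]; exact hfl r hr
    have hAS : 0 ≤ A * S ^ (1 / 2 : ℝ) := by positivity
    have h := abs_normEnergy_sub_le_of_fluxWeight_le hρ hσ hVm hV2 hEEσ hAS ha0 hL0 hfl' hL₁ h12
    simp only [hN]
    calc |L₂ ^ (2 * ρ - 1) * (∫ y, σ (L₂⁻¹ • y) * ‖V y‖ ^ 2) -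
          L₁ ^ (2 * ρ - 1) * (∫ y, σ (L₁⁻¹ • y) * ‖V y‖ ^ 2)| ≤ A * S ^ (1 / 2 : ℝ) / a * L₁ ^ (-a) := h
      _ = B₀ * S ^ (1 / 2 : ℝ) * L₁ ^ (-a) := by rw [hB₀]; ring
  -- smallness at arbitrarily large scales: `N(L'/2) < 2ε`
  have hsmall : ∀ ε : ℝ, 0 < ε → ∀ R₀ : ℝ, 0 < R₀ → ∃ R' : ℝ, R₀ ≤ R' ∧ N R' < 2 * ε := by
    intro ε hε R₀ hR₀
    obtain ⟨L', hL', hlt⟩ := hsub ε hε (2 * R₀)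
    have hL'0 : 0 < L' := by linarith
    refine ⟨L' / 2, by linarith, ?_⟩
    have hB : IntegrableOn (fun y => ‖V y‖ ^ 2) (ball (0 : EuclideanSpace ℝ (Fin 3)) L') volume :=
      (memLp_two_iff_integrable_sq_norm hVm.restrict).1 (memLp_two_ball_of_growth_loc hVm hA _)
    -- `∫ σ(2y/L') |V|² ≤ ∫_{B_{L'}} |V|²`
    have hle : ∫ y, σ ((L' / 2)⁻¹ • y) * ‖V y‖ ^ 2 ≤ ∫ y in ball (0 : EuclideanSpace ℝ (Fin 3)) L', ‖V y‖ ^ 2 := by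
      rw [← integral_indicator measurableSet_ball]
      refine integral_mono_of_nonneg (Eventually.of_forall fun y => mul_nonneg (h0 _) (sq_nonneg _))
        (hB.integrable_indicator measurableSet_ball) (Eventually.of_forall fun y => ?_)
      by_cases hy : y ∈ ball (0 : EuclideanSpace ℝ (Fin 3)) L'
      · rw [indicator_of_mem hy]
        exact mul_le_of_le_one_left (sq_nonneg _) (h1 _)
      · rw [indicator_of_notMem hy]
        rw [mem_ball, dist_zero_right, not_lt] at hy
        have : σ ((L' / 2)⁻¹ • y) = 0 := by
          apply hzero
          rw [norm_smul, norm_inv, Real.norm_of_nonneg (by positivity), le_inv_mul_iff₀ (by positivity)]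
          linarith
        show σ ((L' / 2)⁻¹ • y) * ‖V y‖ ^ 2 ≤ 0
        rw [this, zero_mul]
    have hI0 : 0 ≤ ∫ y in ball (0 : EuclideanSpace ℝ (Fin 3)) L', ‖V y‖ ^ 2 :=
      setIntegral_nonneg measurableSet_ball fun y _ => sq_nonneg _
    have hpow : (L' / 2) ^ (2 * ρ - 1) ≤ 2 * L' ^ (2 * ρ - 1) := by
      rw [Real.div_rpow hL'0.le (by norm_num)]
      rw [div_le_iff₀ (Real.rpow_pos_of_pos two_pos _)]
      have h2 : (2 : ℝ) ^ (2 * ρ - 1) ≥ 2⁻¹ := by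
        rw [show (2 : ℝ)⁻¹ = 2 ^ (-1 : ℝ) by rw [Real.rpow_neg_one]]
        exact Real.rpow_le_rpow_of_exponent_le (by norm_num) (by linarith)
      nlinarith [Real.rpow_nonneg hL'0.le (2 * ρ - 1), h2]
    simp only [hN]
    calc (L' / 2) ^ (2 * ρ - 1) * ∫ y, σ ((L' / 2)⁻¹ • y) * ‖V y‖ ^ 2
        ≤ (2 * L' ^ (2 * ρ - 1)) * ∫ y in ball (0 : EuclideanSpace ℝ (Fin 3)) L', ‖V y‖ ^ 2 :=
          mul_le_mul hpow hle (integral_nonneg fun y => mul_nonneg (h0 _) (sq_nonneg _)) (by positivity)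
      _ = 2 * (L' ^ (2 * ρ - 1) * ∫ y in ball (0 : EuclideanSpace ℝ (Fin 3)) L', ‖V y‖ ^ 2) := by ring
      _ < 2 * ε := by linarith
  -- KEY CLAIM: an admissible `S` on `[L, ∞)` improves to `B₀ S^{1/2} L^{-a}`
  have hkey : ∀ L : ℝ, 1 ≤ L → ∀ S : ℝ, 0 ≤ S → S ≤ 3 * c → (∀ R, L ≤ R → N R ≤ S) →
      ∀ R, L ≤ R → N R ≤ B₀ * S ^ (1 / 2 : ℝ) * L ^ (-a) := by
    intro L hL S hS hS3 hSsup R hR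
    have hL0 : 0 < L := lt_of_lt_of_le one_pos hL
    have hR0 : 0 < R := lt_of_lt_of_le hL0 hR
    have hRa : R ^ (-a) ≤ L ^ (-a) := Real.rpow_le_rpow_of_nonpos hL0 hR (by linarith)
    refine le_of_forall_pos_lt_add fun ε hε => ?_
    obtain ⟨R', hRR', hsmallR'⟩ := hsmall (ε / 2) (by positivity) R hR0
    have ht := htail L hL S hS hS3 hSsup R R' hR hRR'
    have : N R ≤ N R' + B₀ * S ^ (1 / 2 : ℝ) * R ^ (-a) := by
      have := abs_sub_le_iff.1 ht
      linarith [this.2]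
    have hmono : B₀ * S ^ (1 / 2 : ℝ) * R ^ (-a) ≤ B₀ * S ^ (1 / 2 : ℝ) * L ^ (-a) :=
      mul_le_mul_of_nonneg_left hRa (by positivity)
    linarith
  -- ABSORPTION: the tail supremum on `[L, ∞)` is at most `B₀² L^{-2a}`
  have hdecay : ∀ L : ℝ, 1 ≤ L → N L ≤ B₀ ^ 2 * (L ^ (-a)) ^ 2 := by
    intro L hL
    have hL0 : 0 < L := lt_of_lt_of_le one_pos hL
    set T : Set ℝ := N '' Ici L with hT
    have hTne : T.Nonempty := ⟨N L, L, Set.self_mem_Ici, rfl⟩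
    have hTbdd : BddAbove T := ⟨3 * c, by
      rintro _ ⟨R, hR, rfl⟩; exact hN3 R (hL.trans (Set.mem_Ici.1 hR))⟩
    set S : ℝ := sSup T with hSdef
    have hSsup : ∀ R, L ≤ R → N R ≤ S := fun R hR => le_csSup hTbdd ⟨R, Set.mem_Ici.2 hR, rfl⟩
    have hS0 : 0 ≤ S := (hN0 L hL0).trans (hSsup L le_rfl)
    have hS3 : S ≤ 3 * c := csSup_le hTne (by
      rintro _ ⟨R, hR, rfl⟩; exact hN3 R (hL.trans (Set.mem_Ici.1 hR)))
    have hSle : S ≤ B₀ * S ^ (1 / 2 : ℝ) * L ^ (-a) :=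
      csSup_le hTne (by rintro _ ⟨R, hR, rfl⟩; exact hkey L hL S hS0 hS3 hSsup R (Set.mem_Ici.1 hR))
    have habs := le_sq_of_le_mul_sqrt hS0 hB₀0 (Real.rpow_nonneg hL0.le _) hSle
    exact (hSsup L le_rfl).trans habs
  -- CONCLUSION: the energy of every ball vanishes
  have hballzero : ∀ L₀ : ℝ, 0 < L₀ → ∫⁻ y in ball (0 : EuclideanSpace ℝ (Fin 3)) L₀, ‖V y‖ₑ ^ 2 = 0 := by
    intro L₀ hL₀
    refine le_antisymm (ENNReal.le_of_forall_pos_le_add fun δ hδ _ => ?_) zero_le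
    rw [zero_add]
    -- choose `L ≥ max L₀ 1` with `B₀² L^{1-2ρ-2a} < δ`
    have hexp : (1 - 2 * ρ) + -(2 * a) < 0 := by rw [hadef]; linarith
    have htend : Tendsto (fun L : ℝ => B₀ ^ 2 * L ^ ((1 - 2 * ρ) + -(2 * a))) atTop (𝓝 (B₀ ^ 2 * 0)) := by
      refine tendsto_const_nhds.mul ?_
      have := tendsto_rpow_neg_atTop (y := -((1 - 2 * ρ) + -(2 * a))) (by linarith)
      simpa using this
    rw [mul_zero] at htend
    have hev := (htend.eventually (gt_mem_nhds (show (0 : ℝ) < δ from hδ))).and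
      (eventually_ge_atTop (max L₀ 1))
    obtain ⟨L, hLδ, hLge⟩ := hev.exists
    have hL1 : 1 ≤ L := (le_max_right _ _).trans hLge
    have hL0 : 0 < L := lt_of_lt_of_le one_pos hL1
    have hLL₀ : L₀ ≤ L := (le_max_left _ _).trans hLge
    -- `∫_{B_{L₀}} ≤ ∫_{B_L} ≤ ofReal (∫ σ_L |V|²) ≤ ofReal (L^{1-2ρ} B₀² L^{-2a})`
    have h1 := lintegral_ball_sq_le_cutoffEnergy hσs.continuous hσc h0 hone hV2 hL0
    have hNL := hdecay L hL1
    have hI : ∫ y, σ (L⁻¹ • y) * ‖V y‖ ^ 2 ≤ B₀ ^ 2 * L ^ ((1 - 2 * ρ) + -(2 * a)) := by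
      have hRR : L ^ (1 - 2 * ρ) * L ^ (2 * ρ - 1) = 1 := by rw [← Real.rpow_add hL0]; norm_num
      have e2 : (L ^ (-a)) ^ 2 = L ^ (-(2 * a)) := by
        rw [← Real.rpow_natCast, ← Real.rpow_mul hL0.le]; norm_num; ring_nf
      calc ∫ y, σ (L⁻¹ • y) * ‖V y‖ ^ 2 = L ^ (1 - 2 * ρ) * N L := by
            simp only [hN]; rw [← mul_assoc, hRR, one_mul]
        _ ≤ L ^ (1 - 2 * ρ) * (B₀ ^ 2 * (L ^ (-a)) ^ 2) :=
            mul_le_mul_of_nonneg_left hNL (Real.rpow_nonneg hL0.le _)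
        _ = B₀ ^ 2 * (L ^ (1 - 2 * ρ) * L ^ (-(2 * a))) := by rw [e2]; ring
        _ = B₀ ^ 2 * L ^ ((1 - 2 * ρ) + -(2 * a)) := by rw [← Real.rpow_add hL0]
    calc ∫⁻ y in ball (0 : EuclideanSpace ℝ (Fin 3)) L₀, ‖V y‖ₑ ^ 2
        ≤ ∫⁻ y in ball (0 : EuclideanSpace ℝ (Fin 3)) L, ‖V y‖ₑ ^ 2 := lintegral_mono_set (ball_subset_ball hLL₀)
      _ ≤ ENNReal.ofReal (∫ y, σ (L⁻¹ • y) * ‖V y‖ ^ 2) := h1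
      _ ≤ ENNReal.ofReal (B₀ ^ 2 * L ^ ((1 - 2 * ρ) + -(2 * a))) := ENNReal.ofReal_le_ofReal hI
      _ ≤ (δ : ℝ≥0∞) := by
          rw [← ENNReal.ofReal_coe_nnreal]; exact ENNReal.ofReal_le_ofReal hLδ.le
  -- hence `V = 0` a.e.
  have hball_ae : ∀ n : ℕ, ∀ᵐ y ∂(volume.restrict (ball (0 : EuclideanSpace ℝ (Fin 3)) ((n : ℝ) + 1))), V y = 0 := by
    intro n
    have h := hballzero ((n : ℝ) + 1) (by positivity)
    rw [lintegral_eq_zero_iff' (hVm.restrict.enorm.pow_const 2)] at h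
    filter_upwards [h] with y hy
    simpa using hy
  have hunion : (⋃ n : ℕ, ball (0 : EuclideanSpace ℝ (Fin 3)) ((n : ℝ) + 1)) = univ := by
    refine eq_univ_of_forall fun y => mem_iUnion.2 ?_
    obtain ⟨n, hn⟩ := exists_nat_gt ‖y‖
    exact ⟨n, by rw [mem_ball, dist_zero_right]; linarith⟩
  have h := (ae_restrict_iUnion_iff (μ := (volume : Measure (EuclideanSpace ℝ (Fin 3))))
    (fun n : ℕ => ball (0 : EuclideanSpace ℝ (Fin 3)) ((n : ℝ) + 1)) (fun y => V y = 0)).2 hball_ae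
  rw [hunion, Measure.restrict_univ] at h
  exact h

end EnergySaturation

end Summit.NavierStokesRegularity.NavierStokesRegularity.Theorems.PowerGaugeEulerLiouville

end
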